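import Mathlib.NumberTheory.Chebyshev
import Mathlib.Analysis.SpecialFunctions.Pow.Real
import HarnessLib

/-!
# Elementary lemmas for the long-range decay of the friable zeta ratio

Topic `Literature/NumberTheory/Sieve`; a PROVED tool file (no definitions, no named facts) collecting the
elementary inputs of `SmoothZetaDecayLongRangeScale.lean` (Hildebrand–Tenenbaum 1986, Lemma 8 (ii) for
`3 ≤ |t| ≤ y¹²` from scale-wise zero-freeness of `ζ`): the splitting of the primes `≤ m` at `n`
(`primesLE_eq_primesLE_union_filter_Ioc`, `disjoint_primesLE_filter_Ioc`), Chebyshev's function against the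
weight `p^{-σ}` (`theta_mul_rpow_neg_le_sum_primesLE_log_mul_rpow`: `ϑ(y) y^{-σ} ≤ Σ_{p ≤ y} log p · p^{-σ}`), and
three numerical facts about the bottom `exp((12 log y)^{3/4})` of the Vinogradov–Korobov window at scale `y¹²`
(`seventytwo_le_rpow_one_quarter`, `twelve_mul_rpow_three_quarters_le_div_six`,
`eight_le_twelve_mul_rpow_three_quarters`).
-/

noncomputable section

open Real Finset
open scoped Chebyshev

namespace Literature.NumberTheory.Sieve

/-- The primes `≤ m` split into the primes `≤ n` and the primes in `(n, m]` (`n ≤ m`). [folklore] -/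
theorem primesLE_eq_primesLE_union_filter_Ioc {n m : ℕ} (h : n ≤ m) :
    Nat.primesLE m = Nat.primesLE n ∪ (Finset.Ioc n m).filter Nat.Prime := by
  ext p
  simp only [Nat.mem_primesLE, Finset.mem_union, Finset.mem_filter, Finset.mem_Ioc]
  constructor
  · rintro ⟨hpm, hp⟩
    by_cases hpn : p ≤ n
    · exact Or.inl ⟨hpn, hp⟩
    · exact Or.inr ⟨⟨by omega, hpm⟩, hp⟩
  · rintro (⟨hpn, hp⟩ | ⟨⟨-, hpm⟩, hp⟩)
    · exact ⟨hpn.trans h, hp⟩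
    · exact ⟨hpm, hp⟩

/-- The two pieces are disjoint. [folklore] -/
theorem disjoint_primesLE_filter_Ioc (n m : ℕ) :
    Disjoint (Nat.primesLE n) ((Finset.Ioc n m).filter Nat.Prime) :=
  Finset.disjoint_left.2 fun p hp hq => by
    have h1 := (Nat.mem_primesLE.1 hp).1
    have h2 := (Finset.mem_Ioc.1 (Finset.mem_filter.1 hq).1).1
    omega

/-- `ϑ(y) y^{-σ} ≤ Σ_{p ≤ y} log p · p^{-σ}` (`σ ≥ 0`; termwise `y^{-σ} ≤ p^{-σ}`). [folklore] -/
theorem theta_mul_rpow_neg_le_sum_primesLE_log_mul_rpow {σ : ℝ} (hσ : 0 ≤ σ) (y : ℕ) :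
    θ y * (y : ℝ) ^ (-σ) ≤ ∑ p ∈ Nat.primesLE y, Real.log p * (p : ℝ) ^ (-σ) := by
  rw [Chebyshev.theta_eq_sum_primesLE_log, Finset.sum_mul]
  refine Finset.sum_le_sum fun p hp => ?_
  obtain ⟨hpy, hpp⟩ := Nat.mem_primesLE.1 hp
  have hp0 : (0 : ℝ) < p := by exact_mod_cast hpp.pos
  have hpy' : (p : ℝ) ≤ y := by exact_mod_cast hpy
  exact mul_le_mul_of_nonneg_left (Real.rpow_le_rpow_of_nonpos hp0 hpy' (by linarith))
    (Real.log_nonneg (by exact_mod_cast hpp.one_lt.le))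

/-- `72 ≤ ℓ^{1/4}` for `ℓ ≥ 72⁴`. [folklore] -/
theorem seventytwo_le_rpow_one_quarter {ℓ : ℝ} (h : (72 : ℝ) ^ 4 ≤ ℓ) : 72 ≤ ℓ ^ (1 / 4 : ℝ) := by
  have h0 : (0 : ℝ) ≤ 72 ^ 4 := by positivity
  calc (72 : ℝ) = ((72 : ℝ) ^ 4) ^ (1 / 4 : ℝ) := by
        rw [← Real.rpow_natCast, ← Real.rpow_mul (by norm_num)]; norm_num
    _ ≤ ℓ ^ (1 / 4 : ℝ) := Real.rpow_le_rpow h0 h (by norm_num)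

/-- `(12ℓ)^{3/4} ≤ ℓ/6` for `ℓ ≥ 72⁴` (`(12ℓ)^{3/4} ≤ 12 ℓ^{3/4} = 12 ℓ/ℓ^{1/4} ≤ ℓ/6`). [folklore] -/
theorem twelve_mul_rpow_three_quarters_le_div_six {ℓ : ℝ} (h : (72 : ℝ) ^ 4 ≤ ℓ) :
    (12 * ℓ) ^ (3 / 4 : ℝ) ≤ ℓ / 6 := by
  have hℓ0 : 0 < ℓ := lt_of_lt_of_le (by positivity) h
  have h72 := seventytwo_le_rpow_one_quarter h
  have h1 : (12 * ℓ) ^ (3 / 4 : ℝ) ≤ 12 * ℓ ^ (3 / 4 : ℝ) := by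
    rw [Real.mul_rpow (by norm_num) hℓ0.le]
    refine mul_le_mul_of_nonneg_right ?_ (Real.rpow_nonneg hℓ0.le _)
    calc (12 : ℝ) ^ (3 / 4 : ℝ) ≤ (12 : ℝ) ^ (1 : ℝ) :=
          Real.rpow_le_rpow_of_exponent_le (by norm_num) (by norm_num)
      _ = 12 := Real.rpow_one _
  have h2 : ℓ ^ (3 / 4 : ℝ) * ℓ ^ (1 / 4 : ℝ) = ℓ := by
    rw [← Real.rpow_add hℓ0]; norm_num
  have h3 : 0 ≤ ℓ ^ (3 / 4 : ℝ) := Real.rpow_nonneg hℓ0.le _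
  nlinarith

/-- `8 ≤ (12ℓ)^{3/4}` for `ℓ ≥ 2` (`12ℓ ≥ 16 = 2⁴`). [folklore] -/
theorem eight_le_twelve_mul_rpow_three_quarters {ℓ : ℝ} (h : 2 ≤ ℓ) : 8 ≤ (12 * ℓ) ^ (3 / 4 : ℝ) := by
  calc (8 : ℝ) = ((2 : ℝ) ^ 4) ^ (3 / 4 : ℝ) := by
        rw [← Real.rpow_natCast, ← Real.rpow_mul (by norm_num)]; norm_num
    _ ≤ (12 * ℓ) ^ (3 / 4 : ℝ) := Real.rpow_le_rpow (by norm_num) (by linarith) (by norm_num)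

end Literature.NumberTheory.Sieve

end
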